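import Literature.NumberTheory.Automorphic.AutomorphicRepsGLSatakeFlathProofs
import Literature.NumberTheory.Automorphic.AutomorphicTwistSatake
import Literature.NumberTheory.Automorphic.ArthurClozelBaseChangeProofs
import Literature.NumberTheory.Automorphic.GLnAdelicStructureProofs
import Literature.NumberTheory.GaloisRepresentations.HeckeCharacterProofs
import Literature.NumberTheory.GaloisRepresentations.HeckeCharacterRamificationProofs
import HarnessLib

/-!
# Twisting automorphic representations of `GL_n(𝔸_K)` by finite-order characters, in the
Borel–Jacquet model, and the Satake parameters of the twist

Topic `NumberTheory/Automorphic`; companion of `AutomorphicTwist` / `AutomorphicTwistSatake`,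
which construct the twist `π ⊗ χ` and compute its Satake parameters in the tree's `L²` model
(`CuspidalAutomorphicRepGL`: irreducible closed subspaces of `L²_cusp`).  The named facts of the
Langlands–Tunnell decomposition (`TunnellOctahedralGlobal.exists_twist_quadraticSign`, and more
generally everything stated with `AutomorphicRepsGL`) live in the **Borel–Jacquet model**
`AutomorphicRepData (AutomorphyDatum.gl n K hcpt)` (a datum `π = W / W'` of
`(𝔤, K_∞) × GL_n(𝔸_K^∞)`-stable subspaces of the space `𝒜` of automorphic forms, Borel–Jacquet
1979, §4.6) and `CuspidalAutomorphicRepData n K hcpt`, whose bridge to `L²` is itself a named fact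
(`AutomorphicRepsGL.exists_isAssociatedL2`, …).  This file constructs the twist directly in the
Borel–Jacquet model, with complete proofs and no new named fact:

* `mulChar c` (**definition**): multiplication by a character `c : G → ℂˣ` on functions `G → ℂ`,
  a linear automorphism with inverse `mulChar c⁻¹`; `rightTranslation_mulChar`:
  `r(h) (c · φ) = c(h) · (c · r(h) φ)`.
* `heckeOperator_apply_semilinear` (**generic, proved**): for `L` linear with
  `ρ(x) L = c(x) L ρ(x)` and `c ≡ c(g)` on (representatives of) `U g U / U`,
  `[U g U] (L v) = c(g) L ([U g U] v)`; `apply_out_eq_of_mem_orbit`: a homomorphism trivial on `U`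
  is constant on `U g U`.
* Archimedean calculus (`ArchimedeanCalculus`) under `mulChar c` for `c` trivial on the
  one-parameter subgroups `ι(exp X)` (**proved**): `isArchSmooth_mulChar`, `lieDeriv_mulChar`
  (`X (c · φ) = c · X φ`), `applyFree_mulChar`, `zOrbitSpan_mulChar`, `isZFinite_mulChar`,
  `isKFinite_mulChar`; and `apply_expMem_eq_one_of_pow_eq_one`: a character of finite order is
  trivial on exponentials (`exp X = exp(X/m)^m`, `RealMatrixGroup.expMem_eq_pow`).
* `detTwist n χ = χ ∘ det : GL_n(𝔸_K) → ℂˣ` (**definition**) for a Hecke character `χ` of `K`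
  (`GaloisRepresentations.HeckeCharacter`), with: triviality on `GL_n(K)` (`det γ ∈ Kˣ`), on the
  unipotent radicals, and — for `χ` of finite order — on `exp 𝔤 ⊆ GL_n(K_∞)`
  (`detTwist_ofArch_expMem`); continuity; `|χ ∘ det| = 1` for unitary `χ`.
* A finite-order `χ` has a level — a non-zero ideal `𝔪` with `χ ∘ det` trivial on the principal
  congruence subgroup `K(𝔪)`: this is the tree's
  `HeckeCharacter.exists_level_of_isFiniteOrder` (`ArthurClozelBaseChangeProofs`), reused.
* `IsAutomorphicForm.mulChar_detTwist` (**proved**, Borel–Jacquet 1979, §4.2 (a)–(d)): for `χ` of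
  finite order, `(χ ∘ det) · φ` is an automorphic form if `φ` is — left invariance, a level inside
  `U ∩ ker (χ ∘ det)` (`exists_level_le_detTwist_eq_one`: the kernel is open and closed in
  `GL_n(𝔸_K^∞)`), smoothness, `K_∞`- and `Z(𝔤)`-finiteness, moderate growth.
* `IsStableSubmodule.map_mulChar_detTwist`, **`AutomorphicRepData.twist π χ hχ = π ⊗ (χ ∘ det)`**
  (**definition**: `W ↦ W · (χ∘det)`, `W' ↦ W' · (χ∘det)`; irreducibility along the lattice
  isomorphism `W'' ↦ W'' · (χ∘det)⁻¹`), `CuspConditionGL.mulChar_detTwist`,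
  `IsCuspFormGL.mulChar_detTwist` and **`CuspidalAutomorphicRepData.twist`** (Borel–Jacquet 1979,
  4.4–4.6; Jacquet–Langlands 1970, §11; Arthur–Clozel 1989, Ch. 3 §§1, 3–4).
* **`AutomorphicRepData.HasSatakeParamAt.twist`** (**proved**, Arthur–Clozel 1989, Ch. 3, proof
  of Thm. 3.1, p. 172: `t_{π ⊗ η, v} = η(ϖ_v) t_{π, v}`): a Satake parameter `α` of `π` at `v`
  (level `K(𝔫)`, uniformizer `ϖ`) gives the Satake parameter `χ_v(ϖ) · α` of `π ⊗ (χ ∘ det)` at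
  `v`, at level `K(𝔫𝔪)` for a level `𝔪` of `χ ∘ det` prime to `v` — change of level on
  `K(𝔫)`-fixed forms by `heckeOperator_sphericalLevelAt_eq_principalCongruenceLevel`
  (`JacquetLanglandsParts`), `det t_{v,i} = ϖ^i` (`det_heckeDiagAt`), `e_i(z α) = zⁱ e_i(α)`;
  `…twist_of_isUnramifiedAt` (value `χ.valueAtUniformizer v` at unramified `v`) and the
  almost-everywhere form `AutomorphicRepData.eventually_hasSatakeParamAt_twist` (outside the level
  and the finitely many ramified places of `χ`, `HeckeCharacter.finite_ramifiedPlaces_holds`).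

## Design notes

* Only Hecke characters of **finite order** are treated: then `χ ∘ det` is trivial on `exp 𝔤`
  (so Lie derivatives commute with the twist on the nose and no smoothness of `χ_∞ ∘ det` is
  needed), `|χ| = 1`, and `χ` has a level.  This covers the quadratic characters `ω_{E/F}` of
  Langlands–Tunnell and Arthur–Clozel's `η` (of prime order `l`); general unitary `χ` would need
  the archimedean calculus of `|det|^{it} sgn(det)^ε`.
* The twist is by `χ ∘ det` itself (`(π ⊗ χ)(g) ∋ χ(det g) φ(g)`), so that
  `t_{π ⊗ χ, v} = χ_v(ϖ_v) t_{π,v}`; `AutomorphicTwist.twistByChar` uses `(χ ∘ det)⁻¹` on the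
  left-coset `L²`-model for the same normalisation (see its conventions).  For quadratic `χ` the
  two agree.
* Typing: forms are functions on `(AdelicGroupData.gl n K).Adelic` (definitionally
  `GL (Fin n) (AdeleRing (𝓞 K) K)`), as in `AutomorphicRepsGL`; `detTwist_apply'` is the unfolding
  lemma at that type.  `open scoped Classical` is needed to mention the `GL_n` automorphy datum
  (decidability of real/complex places inside `mixedSpace K`), as in `AutomorphicRepsGL`.
* Nothing here restates a named fact; the file serves the reduction of
  `exists_twist_quadraticSign` to Artin reciprocity (`LanglandsTunnellTwist`).

## References

* A. Borel, H. Jacquet, *Automorphic forms and automorphic representations*, Proc. Sympos. Pure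
  Math. 33 (Corvallis 1979), part 1, §4.2–4.6. [BorelJacquet1979]
* H. Jacquet, R. P. Langlands, *Automorphic Forms on GL(2)*, LNM 114 (1970), §11.
  [JacquetLanglands1970]
* J. Arthur, L. Clozel, *Simple algebras, base change, and the advanced theory of the trace
  formula*, Ann. of Math. Stud. 120 (1989), Ch. 3, §1 and proof of Thm. 3.1 (p. 172).
  [ArthurClozelAMS120]
* J. Neukirch, *Algebraic Number Theory* (1999), Ch. VII §6, (6.10)–(6.12). [NeukirchANT1999]
-/

noncomputable section

open scoped MatrixGroups
open NumberField IsDedekindDomain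

namespace Literature.NumberTheory.Automorphic

/-! ### Multiplication by a character of the group -/

section MulChar

variable {G : Type*} [Group G]

/-- **Multiplication by a character**: for a character `c : G → ℂˣ`, the linear operator
`φ ↦ c · φ` on functions `G → ℂ` (`(c · φ)(g) = c(g) φ(g)`). For `G = GL_n(𝔸_K)` and
`c = χ ∘ det` this realises the twist `π ⊗ (χ ∘ det)` of a space of automorphic forms `π`
(Borel–Jacquet 1979, §4.6; Arthur–Clozel 1989, Ch. 3 §1). [folklore] -/
def mulChar (c : G →* ℂˣ) : (G → ℂ) →ₗ[ℂ] (G → ℂ) where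
  toFun φ g := (c g : ℂ) * φ g
  map_add' φ ψ := funext fun g => mul_add _ _ _
  map_smul' a φ := funext fun g => by
    change (c g : ℂ) * (a * φ g) = a * ((c g : ℂ) * φ g)
    ring

/-- `mulChar c φ g = c g * φ g`. [folklore] -/
@[simp]
theorem mulChar_apply (c : G →* ℂˣ) (φ : G → ℂ) (g : G) : mulChar c φ g = (c g : ℂ) * φ g := rfl

/-- `c · (d · φ) = (c d) · φ`. [folklore] -/
theorem mulChar_mulChar (c d : G →* ℂˣ) (φ : G → ℂ) :
    mulChar c (mulChar d φ) = mulChar (c * d) φ := by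
  funext g
  simp only [mulChar_apply, MonoidHom.mul_apply, Units.val_mul]
  ring

/-- `1 · φ = φ`. [folklore] -/
@[simp]
theorem mulChar_one (φ : G → ℂ) : mulChar (1 : G →* ℂˣ) φ = φ := by
  funext g
  simp

/-- `c⁻¹ · (c · φ) = φ`. [folklore] -/
@[simp]
theorem mulChar_inv_mulChar (c : G →* ℂˣ) (φ : G → ℂ) : mulChar c⁻¹ (mulChar c φ) = φ := by
  funext g
  simp [mulChar_apply]

/-- `c · (c⁻¹ · φ) = φ`. [folklore] -/
@[simp]
theorem mulChar_mulChar_inv (c : G →* ℂˣ) (φ : G → ℂ) : mulChar c (mulChar c⁻¹ φ) = φ := by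
  funext g
  simp [mulChar_apply]

/-- Multiplication by a character is injective. [folklore] -/
theorem mulChar_injective (c : G →* ℂˣ) : Function.Injective (mulChar c) := fun φ ψ h => by
  rw [← mulChar_inv_mulChar c φ, h, mulChar_inv_mulChar]

/-- `(W · c) · c⁻¹ = W` for a subspace `W`. [folklore] -/
theorem map_mulChar_inv_map_mulChar (c : G →* ℂˣ) (W : Submodule ℂ (G → ℂ)) :
    (W.map (mulChar c)).map (mulChar c⁻¹) = W := by
  rw [← Submodule.map_comp]
  convert Submodule.map_id W
  exact LinearMap.ext fun φ => mulChar_inv_mulChar c φ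

/-- `(W · c⁻¹) · c = W` for a subspace `W`. [folklore] -/
theorem map_mulChar_map_mulChar_inv (c : G →* ℂˣ) (W : Submodule ℂ (G → ℂ)) :
    (W.map (mulChar c⁻¹)).map (mulChar c) = W := by
  rw [← Submodule.map_comp]
  convert Submodule.map_id W
  exact LinearMap.ext fun φ => mulChar_mulChar_inv c φ

/-- `ψ ∈ W · c ↔ c⁻¹ · ψ ∈ W`. [folklore] -/
theorem mem_map_mulChar_iff (c : G →* ℂˣ) (W : Submodule ℂ (G → ℂ)) (ψ : G → ℂ) :
    ψ ∈ W.map (mulChar c) ↔ mulChar c⁻¹ ψ ∈ W := by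
  constructor
  · rintro ⟨φ, hφ, rfl⟩
    rwa [mulChar_inv_mulChar]
  · intro h
    exact ⟨_, h, mulChar_mulChar_inv c ψ⟩

/-- `c · φ ∈ W · c ↔ φ ∈ W`. [folklore] -/
theorem mulChar_mem_map_mulChar_iff (c : G →* ℂˣ) (W : Submodule ℂ (G → ℂ)) (φ : G → ℂ) :
    mulChar c φ ∈ W.map (mulChar c) ↔ φ ∈ W := by
  rw [mem_map_mulChar_iff, mulChar_inv_mulChar]

end MulChar

/-! ### Hecke operators of twisted vectors (generic) -/

section HeckeTwist

variable {k G V : Type*} [CommRing k] [Group G] [AddCommGroup V] [Module k V]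

/-- **Hecke operators and semilinear operators.** Let `L : V → V` be linear with
`ρ(x) L = c(x) L ρ(x)` for a scalar function `c` on `G`, and let `g ∈ G` be such that `c` takes
the value `c g` at the chosen representatives of the left cosets in `U g U`. Then
`[U g U] (L v) = c(g) L ([U g U] v)` for every `v` (in the junk case of an infinite double coset
both sides vanish). This is the computation behind `t_{π ⊗ χ, v} = χ(ϖ_v) t_{π, v}`
(Arthur–Clozel 1989, Ch. 3, proof of Thm. 3.1, p. 172). [folklore] -/
theorem heckeOperator_apply_semilinear (ρ : Representation k G V) (U : Subgroup G)
    (L : V →ₗ[k] V) (c : G → k) (hL : ∀ x v, ρ x (L v) = c x • L (ρ x v)) (g : G)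
    (hc : ∀ y ∈ MulAction.orbit U (g : G ⧸ U), c (Quotient.out y) = c g) (v : V) :
    heckeOperator ρ U g (L v) = c g • L (heckeOperator ρ U g v) := by
  classical
  by_cases hfin : (MulAction.orbit U (g : G ⧸ U)).Finite
  · rw [heckeOperator, finsum_mem_eq_finite_toFinset_sum _ hfin, LinearMap.sum_apply,
      LinearMap.sum_apply, map_sum, Finset.smul_sum]
    refine Finset.sum_congr rfl fun y hy => ?_
    rw [hL, hc y ((Set.Finite.mem_toFinset _).mp hy)]
  · rw [heckeOperator_eq_zero_of_infinite ρ U g hfin, LinearMap.zero_apply, LinearMap.zero_apply,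
      map_zero, smul_zero]

/-- A homomorphism `c : G → M` (commutative `M`) trivial on `U` is constant, equal to `c g`, on
the representatives of the left cosets in `U g U`. [folklore] -/
theorem apply_out_eq_of_mem_orbit {M : Type*} [CommGroup M] (c : G →* M) (U : Subgroup G)
    (hU : ∀ u ∈ U, c u = 1) (g : G) {y : G ⧸ U} (hy : y ∈ MulAction.orbit U (g : G ⧸ U)) :
    c (Quotient.out y) = c g := by
  obtain ⟨⟨u, hu⟩, rfl⟩ := MulAction.mem_orbit_iff.mp hy
  obtain ⟨u', hu'⟩ := QuotientGroup.mk_out_eq_mul U (u * g)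
  change c (Quotient.out (((u * g : G)) : G ⧸ U)) = c g
  change (((u * g : G) : G ⧸ U)).out = u * g * u' at hu'
  rw [show Quotient.out (((u * g : G)) : G ⧸ U) = (((u * g : G) : G ⧸ U)).out from rfl, hu',
    map_mul, map_mul, hU u hu, hU _ u'.2, one_mul, mul_one]

end HeckeTwist

/-! ### Multiplication by a character and the archimedean calculus -/

section ArchCalculus

-- Mathlib idiom (Mathlib/Algebra/Lie/OfAssociative.lean); needed to mention Lie subalgebras of matrix algebras
attribute [local instance 100] LieRing.ofAssociativeRing

variable {A : Type*} [NormedCommRing A] [NormedAlgebra ℝ A] [NormedAlgebra ℚ A] [CompleteSpace A]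
  [StarRing A] {N : Type*} [Fintype N] [DecidableEq N] {H : RealMatrixGroup A N}
  {G : Type*} [Group G] (ι : H.carrier →* G) {c : G →* ℂˣ}

omit [StarRing A] in
/-- `exp (m X) = (exp X)^m` in `GL N A`. [folklore] -/
theorem expGL_natCast_smul (m : ℕ) (X : Matrix N N A) : expGL ((m : ℝ) • X) = expGL X ^ m := by
  induction m with
  | zero => rw [Nat.cast_zero, zero_smul, expGL_zero, pow_zero]
  | succ m ih => rw [Nat.cast_succ, add_smul, expGL_smul_add_smul, one_smul, ih, pow_succ]

/-- `exp X = (exp (X / m))^m` in `G`, `m ≥ 1` (divisibility of one-parameter subgroups).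
[folklore] -/
theorem _root_.Literature.NumberTheory.Automorphic.RealMatrixGroup.expMem_eq_pow
    (H : RealMatrixGroup A N) (X : H.lie) {m : ℕ} (hm : 0 < m) :
    H.expMem X = H.expMem ((m : ℝ)⁻¹ • X) ^ m := by
  refine Subtype.ext ?_
  rw [SubmonoidClass.coe_pow, RealMatrixGroup.coe_expMem, RealMatrixGroup.coe_expMem,
    show ((((m : ℝ)⁻¹ • X : H.lie)) : Matrix N N A) = (m : ℝ)⁻¹ • (X : Matrix N N A) from rfl,
    ← expGL_natCast_smul, smul_smul, mul_inv_cancel₀ (Nat.cast_ne_zero.mpr hm.ne'), one_smul]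

/-- A character of finite order on `G` is trivial on the one-parameter subgroups `ι (exp X)`:
`c (ι (exp X)) = c (ι (exp (X/m)))^m = 1` if `c^m = 1`. [folklore] -/
theorem apply_expMem_eq_one_of_pow_eq_one {m : ℕ} (hm : 0 < m) (hcm : ∀ g, c g ^ m = 1)
    (X : H.lie) : c (ι (H.expMem X)) = 1 := by
  rw [RealMatrixGroup.expMem_eq_pow H X hm, map_pow, map_pow, hcm]

/-- `(c · φ) (g · ι (exp X)) = c(g) φ (g · ι (exp X))` when `c` is trivial on exponentials.
[folklore] -/
theorem mulChar_apply_mul_expMem (hc : ∀ X : H.lie, c (ι (H.expMem X)) = 1) (φ : G → ℂ) (g : G)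
    (X : H.lie) : mulChar c φ (g * ι (H.expMem X)) = (c g : ℂ) * φ (g * ι (H.expMem X)) := by
  rw [mulChar_apply, map_mul, hc, mul_one]

open scoped Matrix.Norms.Operator in
/-- Multiplication by a character trivial on exponentials preserves smoothness in the
archimedean variable. [folklore] -/
theorem isArchSmooth_mulChar (hc : ∀ X : H.lie, c (ι (H.expMem X)) = 1) {φ : G → ℂ}
    (hφ : IsArchSmooth ι φ) : IsArchSmooth ι (mulChar c φ) := by
  intro g
  simp only [mulChar_apply_mul_expMem ι hc]
  exact contDiff_const.mul (hφ g)

/-- The Lie derivative commutes with multiplication by a character trivial on exponentials: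
`X (c · φ) = c · (X φ)`. [folklore] -/
theorem lieDeriv_mulChar (hc : ∀ X : H.lie, c (ι (H.expMem X)) = 1) (X : H.lie) (φ : G → ℂ) :
    lieDeriv ι X (mulChar c φ) = mulChar c (lieDeriv ι X φ) := by
  funext g
  rw [mulChar_apply, lieDeriv, lieDeriv]
  simp_rw [mulChar_apply_mul_expMem ι hc]
  exact deriv_const_mul_field _

/-- Iterated Lie derivatives commute with multiplication by a character trivial on
exponentials. [folklore] -/
theorem iterLieDeriv_mulChar (hc : ∀ X : H.lie, c (ι (H.expMem X)) = 1) (w : List H.lie)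
    (φ : G → ℂ) : iterLieDeriv ι w (mulChar c φ) = mulChar c (iterLieDeriv ι w φ) := by
  induction w with
  | nil => rfl
  | cons X w ih => rw [iterLieDeriv_cons, iterLieDeriv_cons, ih, lieDeriv_mulChar ι hc]

/-- The word action of `ℝ⟨𝔤⟩` commutes with multiplication by a character trivial on
exponentials. [folklore] -/
theorem applyFree_mulChar (hc : ∀ X : H.lie, c (ι (H.expMem X)) = 1) (p : FreeAlgebra ℝ H.lie)
    (φ : G → ℂ) : applyFree ι p (mulChar c φ) = mulChar c (applyFree ι p φ) := by
  simp only [applyFree, iterLieDeriv_mulChar ι hc, Finsupp.sum, map_sum, map_smul]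

/-- The `Z(𝔤)`-orbit span of `c · φ` is `c · (Z(𝔤)`-orbit span of `φ)`. [folklore] -/
theorem zOrbitSpan_mulChar (hc : ∀ X : H.lie, c (ι (H.expMem X)) = 1) (φ : G → ℂ) :
    zOrbitSpan ι (mulChar c φ) = (zOrbitSpan ι φ).map (mulChar c) := by
  rw [zOrbitSpan, zOrbitSpan, Submodule.map_span]
  congr 1
  ext ψ
  simp only [Set.mem_setOf_eq, Set.mem_image]
  constructor
  · rintro ⟨p, hp, rfl⟩
    exact ⟨_, ⟨p, hp, rfl⟩, (applyFree_mulChar ι hc p φ).symm⟩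
  · rintro ⟨_, ⟨p, hp, rfl⟩, rfl⟩
    exact ⟨p, hp, (applyFree_mulChar ι hc p φ).symm⟩

/-- Multiplication by a character trivial on exponentials preserves `Z(𝔤)`-finiteness.
[folklore] -/
theorem isZFinite_mulChar (hc : ∀ X : H.lie, c (ι (H.expMem X)) = 1) {φ : G → ℂ}
    (h : IsZFinite ι φ) : IsZFinite ι (mulChar c φ) := by
  unfold IsZFinite at h ⊢
  rw [zOrbitSpan_mulChar ι hc]
  infer_instance

/-- Right archimedean translates of `c · φ`: `r(h) (c · φ) = c(ι h) · (c · r(h) φ)`. [folklore] -/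
theorem archTranslate_mulChar (h : H.carrier) (φ : G → ℂ) :
    archTranslate ι h (mulChar c φ) = (c (ι h) : ℂ) • mulChar c (archTranslate ι h φ) := by
  funext g
  simp only [archTranslate_apply, mulChar_apply, Pi.smul_apply, smul_eq_mul, map_mul, Units.val_mul]
  ring

/-- The span of the `K`-translates of `c · φ` lies in `c · (span of the K-translates of φ)`.
[folklore] -/
theorem kTranslateSpan_mulChar_le (φ : G → ℂ) :
    kTranslateSpan ι (mulChar c φ) ≤ (kTranslateSpan ι φ).map (mulChar c) := by
  rw [kTranslateSpan, Submodule.span_le]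
  rintro _ ⟨k, rfl⟩
  change archTranslate ι (Subgroup.inclusion H.maximalCompact_le_carrier k) (mulChar c φ) ∈ _
  rw [archTranslate_mulChar]
  exact Submodule.smul_mem _ _ (Submodule.mem_map_of_mem (archTranslate_mem_kTranslateSpan ι k φ))

/-- Multiplication by a character preserves `K`-finiteness. [folklore] -/
theorem isKFinite_mulChar {φ : G → ℂ} (h : IsKFinite ι φ) : IsKFinite ι (mulChar c φ) := by
  unfold IsKFinite at h ⊢
  exact Submodule.finiteDimensional_of_le (kTranslateSpan_mulChar_le ι φ)

end ArchCalculus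

/-! ### The character `χ ∘ det` of `GL_n(𝔸_K)` -/

section DetTwist

variable (n : ℕ) {K : Type} [Field K] [NumberField K]

/-- The character `χ ∘ det : GL_n(𝔸_K) → ℂˣ` attached to a Hecke character `χ` of `K`
(Arthur–Clozel 1989, Ch. 3 §1; compare `detChar`, its bundling as a unitary automorphic
character for unitary `χ` trivial on `ℝ_{>0}`). [folklore] -/
def detTwist (χ : GaloisRepresentations.HeckeCharacter K) : (AdelicGroupData.gl n K).Adelic →* ℂˣ :=
  χ.toContinuousMonoidHom.toMonoidHom.comp Matrix.GeneralLinearGroup.det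

/-- `detTwist n χ g = χ (det g)` (definitional). [folklore] -/
@[simp]
theorem detTwist_apply (χ : GaloisRepresentations.HeckeCharacter K)
    (g : GL (Fin n) (AdeleRing (𝓞 K) K)) :
    detTwist n χ g = χ (Matrix.GeneralLinearGroup.det g) := rfl

/-- `detTwist n χ g = χ (det g)`, for `g` typed on the adelic group datum (definitional).
[folklore] -/
@[simp]
theorem detTwist_apply' (χ : GaloisRepresentations.HeckeCharacter K)
    (g : (AdelicGroupData.gl n K).Adelic) :
    detTwist n χ g = χ (Matrix.GeneralLinearGroup.det (show GL (Fin n) (AdeleRing (𝓞 K) K) from g)) :=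
  rfl

/-- `(χ ψ) ∘ det = (χ ∘ det) (ψ ∘ det)`. [folklore] -/
theorem detTwist_mul (χ ψ : GaloisRepresentations.HeckeCharacter K) :
    detTwist n (χ * ψ) = detTwist n χ * detTwist n ψ :=
  MonoidHom.ext fun g => by
    rw [MonoidHom.mul_apply, detTwist_apply', detTwist_apply', detTwist_apply',
      GaloisRepresentations.HeckeCharacter.mul_apply]

/-- `χ⁻¹ ∘ det = (χ ∘ det)⁻¹`. [folklore] -/
theorem detTwist_inv (χ : GaloisRepresentations.HeckeCharacter K) :
    detTwist n χ⁻¹ = (detTwist n χ)⁻¹ :=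
  MonoidHom.ext fun g => by
    rw [MonoidHom.inv_apply, detTwist_apply', detTwist_apply',
      GaloisRepresentations.HeckeCharacter.inv_apply]

/-- `1 ∘ det = 1`. [folklore] -/
@[simp]
theorem detTwist_one : detTwist n (1 : GaloisRepresentations.HeckeCharacter K) = 1 :=
  MonoidHom.ext fun g => by
    rw [MonoidHom.one_apply, detTwist_apply', GaloisRepresentations.HeckeCharacter.one_apply]

/-- `χ^m ∘ det = (χ ∘ det)^m`. [folklore] -/
theorem detTwist_pow (χ : GaloisRepresentations.HeckeCharacter K) (m : ℕ) :
    detTwist n (χ ^ m) = detTwist n χ ^ m :=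
  MonoidHom.ext fun g => by
    rw [MonoidHom.pow_apply, detTwist_apply', detTwist_apply',
      GaloisRepresentations.HeckeCharacter.pow_apply]

/-- `χ ∘ det` is continuous. [folklore] -/
theorem continuous_detTwist (χ : GaloisRepresentations.HeckeCharacter K) :
    Continuous (detTwist n χ) :=
  χ.toContinuousMonoidHom.continuous.comp Matrix.GeneralLinearGroup.continuous_det

/-- `|χ (det g)| = 1` for unitary `χ`. [folklore] -/
theorem norm_detTwist {χ : GaloisRepresentations.HeckeCharacter K} (hχ : χ.IsUnitary)
    (g : GL (Fin n) (AdeleRing (𝓞 K) K)) : ‖(detTwist n χ g : ℂ)‖ = 1 :=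
  hχ _

/-- `χ ∘ det` is trivial on `GL_n(K)` (`det γ ∈ Kˣ`). [folklore] -/
theorem detTwist_eq_one_of_mem_arithmeticSubgroup (χ : GaloisRepresentations.HeckeCharacter K)
    {γ : GL (Fin n) (AdeleRing (𝓞 K) K)} (hγ : γ ∈ (AdelicGroupData.gl n K).arithmeticSubgroup) :
    detTwist n χ γ = 1 := by
  obtain ⟨γ₀, rfl⟩ := hγ
  exact χ.map_principal (GLn.det_toAdelic_mem_principalIdeles n γ₀)

/-- `χ ∘ det` is trivial on the unipotent radicals `N_k(𝔸_K)`. [folklore] -/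
theorem detTwist_glUnipotent (χ : GaloisRepresentations.HeckeCharacter K) {k : ℕ}
    (X : Multiplicative (blockNilpotent n k (AdeleRing (𝓞 K) K))) :
    detTwist n χ (glUnipotent n k K X) = 1 := by
  rw [detTwist_apply, GLn.det_glUnipotent, map_one]

/-- A finite-order `χ` gives a finite-order `χ ∘ det`: `(χ (det g))^m = 1` for some `m ≥ 1` and
all `g`. [folklore] -/
theorem exists_detTwist_pow_eq_one {χ : GaloisRepresentations.HeckeCharacter K} (hχ : χ.IsFiniteOrder) :
    ∃ m : ℕ, 0 < m ∧ ∀ g : GL (Fin n) (AdeleRing (𝓞 K) K), detTwist n χ g ^ m = 1 := by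
  obtain ⟨m, hm, h1⟩ := hχ.exists_pow_eq_one
  exact ⟨m, hm, fun g => by rw [← MonoidHom.pow_apply, ← detTwist_pow, h1, detTwist_one, MonoidHom.one_apply]⟩

variable {n}

open scoped Classical in
/-- **`χ ∘ det` is trivial on the archimedean one-parameter subgroups** `exp(𝔤)` of
`GL_n(K_∞) ↪ GL_n(𝔸_K)`, for `χ` of finite order (divisibility: `exp X = exp(X/m)^m`).
[folklore] -/
theorem detTwist_ofArch_expMem {hcpt : isCompact_glFiniteIntegralLevel n K}
    {χ : GaloisRepresentations.HeckeCharacter K} (hχ : χ.IsFiniteOrder)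
    (X : (AutomorphyDatum.gl n K hcpt).arch.lie) :
    detTwist n χ ((AutomorphyDatum.gl n K hcpt).ofArch ((AutomorphyDatum.gl n K hcpt).arch.expMem X)) = 1 := by
  obtain ⟨m, hm, hcm⟩ := exists_detTwist_pow_eq_one n hχ
  exact apply_expMem_eq_one_of_pow_eq_one _ hm hcm X

end DetTwist

/-! ### Twisting automorphic forms on `GL_n(𝔸_K)` -/

section Forms

open scoped Classical

variable {n : ℕ} {K : Type} [Field K] [NumberField K] {hcpt : isCompact_glFiniteIntegralLevel n K}

/-- Right translation and multiplication by a character: `r(h) (c · φ) = c(h) · (c · r(h) φ)`.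
[folklore] -/
theorem rightTranslation_mulChar (𝒢 : AdelicGroupData K) (c : 𝒢.Adelic →* ℂˣ) (h : 𝒢.Adelic)
    (φ : 𝒢.Adelic → ℂ) :
    rightTranslation 𝒢 h (mulChar c φ) = (c h : ℂ) • mulChar c (rightTranslation 𝒢 h φ) := by
  funext g
  simp only [rightTranslation_apply, mulChar_apply, Pi.smul_apply, smul_eq_mul, map_mul, Units.val_mul]
  ring

/-- **A level for `χ ∘ det`**: every admissible level `U = {1} × U₀` of `GL_n` contains an
admissible level on which `χ ∘ det` is trivial (`χ` of finite order): `U₀ ∩ ker (χ ∘ det)` is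
compact open, the kernel being open (finite image) and closed. [folklore] -/
theorem exists_level_le_detTwist_eq_one {χ : GaloisRepresentations.HeckeCharacter K} (hχ : χ.IsFiniteOrder)
    {U : Subgroup (GL (Fin n) (AdeleRing (𝓞 K) K))} (hU : U ∈ finiteLevelsGL n K) :
    ∃ U' ∈ finiteLevelsGL n K, U' ≤ U ∧ ∀ u ∈ U', detTwist n χ u = 1 := by
  obtain ⟨U₀, hU₀o, hU₀c, rfl⟩ := hU
  obtain ⟨m, hm, hcm⟩ := exists_detTwist_pow_eq_one n hχ
  haveI : NeZero m := ⟨hm.ne'⟩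
  set c' : GL (Fin n) (FiniteAdeleRing (𝓞 K) K) →* ℂˣ := (detTwist n χ).comp (GLn.ofFinite n K)
    with hc'
  have hc'c : Continuous c' := (continuous_detTwist n χ).comp (GLn.continuous_ofFinite n K)
  set F : Set ℂˣ := {z | z ^ m = 1 ∧ z ≠ 1} with hF
  have hFfin : F.Finite :=
    (Set.finite_range fun z : rootsOfUnity m ℂ => (z : ℂˣ)).subset fun z hz =>
      ⟨⟨z, (mem_rootsOfUnity m z).2 hz.1⟩, rfl⟩
  have hker : (c'.ker : Set (GL (Fin n) (FiniteAdeleRing (𝓞 K) K))) = c' ⁻¹' Fᶜ := by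
    ext x
    simp only [SetLike.mem_coe, MonoidHom.mem_ker, Set.mem_preimage, Set.mem_compl_iff, hF,
      Set.mem_setOf_eq, not_and, not_not]
    exact ⟨fun h _ => h, fun h => h (hcm _)⟩
  have hopen : IsOpen (c'.ker : Set (GL (Fin n) (FiniteAdeleRing (𝓞 K) K))) := by
    rw [hker]
    exact hFfin.isClosed.isOpen_compl.preimage hc'c
  have hclosed : IsClosed (c'.ker : Set (GL (Fin n) (FiniteAdeleRing (𝓞 K) K))) := by
    have : (c'.ker : Set (GL (Fin n) (FiniteAdeleRing (𝓞 K) K))) = c' ⁻¹' {1} := by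
      ext x; simp [MonoidHom.mem_ker]
    rw [this]
    exact isClosed_singleton.preimage hc'c
  refine ⟨(U₀ ⊓ c'.ker).map (GLn.ofFinite n K),
    ⟨U₀ ⊓ c'.ker, hU₀o.inter hopen, hU₀c.inter_right hclosed, rfl⟩,
    Subgroup.map_mono inf_le_left, ?_⟩
  rintro _ ⟨u, hu, rfl⟩
  exact hu.2

/-- **Twists of automorphic forms are automorphic forms** (Borel–Jacquet 1979, §4.2–4.3: the
conditions (a)–(d) for `(χ ∘ det) · φ`). For `χ` of finite order: left `GL_n(K)`-invariance as
`det γ ∈ Kˣ`; a level inside `U ∩ ker(χ ∘ det)`; smoothness, `K_∞`-finiteness and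
`Z(𝔤)`-finiteness since `χ ∘ det` is trivial on `exp 𝔤` and scalar on `K_∞`-translates
(`X (c · φ) = c · X φ`); moderate growth as `|χ| = 1`. [cite: BorelJacquet1979, §4.2–4.3] -/
theorem IsAutomorphicForm.mulChar_detTwist {χ : GaloisRepresentations.HeckeCharacter K} (hχ : χ.IsFiniteOrder)
    {φ : (AdelicGroupData.gl n K).Adelic → ℂ} (hφ : IsAutomorphicForm (AutomorphyDatum.gl n K hcpt) φ) :
    IsAutomorphicForm (AutomorphyDatum.gl n K hcpt) (mulChar (detTwist n χ) φ) where
  leftInvariant γ hγ g := by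
    rw [mulChar_apply, mulChar_apply, map_mul, detTwist_eq_one_of_mem_arithmeticSubgroup n χ hγ,
      one_mul, hφ.leftInvariant γ hγ g]
  exists_level := by
    obtain ⟨U, hU, hUφ⟩ := hφ.exists_level
    obtain ⟨U', hU', hle, hc⟩ := exists_level_le_detTwist_eq_one hχ hU
    exact ⟨U', hU', fun u hu g => by
      rw [mulChar_apply, mulChar_apply, map_mul, hc u hu, mul_one, hUφ u (hle hu) g]⟩
  archSmooth := isArchSmooth_mulChar _ (detTwist_ofArch_expMem hχ) hφ.archSmooth
  kFinite := isKFinite_mulChar _ hφ.kFinite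
  zFinite := isZFinite_mulChar _ (detTwist_ofArch_expMem hχ) hφ.zFinite
  moderateGrowth := by
    obtain ⟨C, r, hC⟩ := hφ.moderateGrowth
    exact ⟨C, r, fun g => by
      rw [mulChar_apply, norm_mul, norm_detTwist n hχ.isUnitary, one_mul]; exact hC g⟩

/-- The twist `W · (χ ∘ det)` of a space `W` of automorphic forms consists of automorphic
forms. [cite: BorelJacquet1979, §4.2–4.3] -/
theorem map_mulChar_le_automorphicForms {χ : GaloisRepresentations.HeckeCharacter K} (hχ : χ.IsFiniteOrder)
    {W : Submodule ℂ ((AdelicGroupData.gl n K).Adelic → ℂ)}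
    (hW : W ≤ automorphicForms (AutomorphyDatum.gl n K hcpt)) :
    W.map (mulChar (detTwist n χ)) ≤ automorphicForms (AutomorphyDatum.gl n K hcpt) := by
  refine (Submodule.map_mono hW).trans ?_
  rw [automorphicForms, Submodule.map_span, Submodule.span_le]
  rintro _ ⟨φ, hφ, rfl⟩
  exact Submodule.subset_span (IsAutomorphicForm.mulChar_detTwist hχ hφ)

/-- **Twists of stable subspaces are stable** (`(𝔤, K_∞) × GL_n(𝔸_K^∞)`-submodules of `𝒜`):
`r(h) (c · φ) = c(h) · (c · r(h) φ)` and `X (c · φ) = c · X φ`. Borel–Jacquet 1979, §4.3, §4.6.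
[cite: BorelJacquet1979, §4.3 and §4.6] -/
theorem IsStableSubmodule.map_mulChar_detTwist {χ : GaloisRepresentations.HeckeCharacter K} (hχ : χ.IsFiniteOrder)
    {W : Submodule ℂ ((AdelicGroupData.gl n K).Adelic → ℂ)}
    (hW : IsStableSubmodule (AutomorphyDatum.gl n K hcpt) W) :
    IsStableSubmodule (AutomorphyDatum.gl n K hcpt) (W.map (mulChar (detTwist n χ))) where
  le_automorphicForms := map_mulChar_le_automorphicForms hχ hW.le_automorphicForms
  finite_stable h hh := by
    rintro _ ⟨φ, hφ, rfl⟩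
    rw [Submodule.mem_comap, rightTranslation_mulChar]
    exact Submodule.smul_mem _ _ (Submodule.mem_map_of_mem (hW.finite_stable h hh hφ))
  k_stable k := by
    rintro _ ⟨φ, hφ, rfl⟩
    rw [Submodule.mem_comap, rightTranslation_mulChar]
    exact Submodule.smul_mem _ _ (Submodule.mem_map_of_mem (hW.k_stable k hφ))
  lie_stable X := by
    rintro _ ⟨φ, hφ, rfl⟩
    rw [lieDeriv_mulChar _ (detTwist_ofArch_expMem hχ)]
    exact Submodule.mem_map_of_mem (hW.lie_stable X φ hφ)

/-- **The twist `π ⊗ (χ ∘ det)` of an automorphic representation of `GL_n(𝔸_K)`** in the sense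
of Borel–Jacquet (a datum `π = W / W'` of stable subspaces of `𝒜`), by a Hecke character `χ` of
finite order: `W ↦ W · (χ ∘ det)`, `W' ↦ W' · (χ ∘ det)`. Irreducibility is transported along
the lattice isomorphism `W'' ↦ W'' · (χ ∘ det)⁻¹`. Borel–Jacquet 1979, §4.6; Jacquet–Langlands,
LNM 114 (1970), §11; Arthur–Clozel 1989, Ch. 3 §1 (`π ⊗ χ`).
[cite: BorelJacquet1979, §4.6] [cite: ArthurClozelAMS120, Ch. 3, Thm. 3.1 (p. 172)] -/
def AutomorphicRepData.twist (π : AutomorphicRepData (AutomorphyDatum.gl n K hcpt))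
    (χ : GaloisRepresentations.HeckeCharacter K) (hχ : χ.IsFiniteOrder) :
    AutomorphicRepData (AutomorphyDatum.gl n K hcpt) where
  W := π.W.map (mulChar (detTwist n χ))
  W' := π.W'.map (mulChar (detTwist n χ))
  lt := Submodule.map_strictMono_of_injective (mulChar_injective _) π.lt
  stable := π.stable.map_mulChar_detTwist hχ
  stable' := π.stable'.map_mulChar_detTwist hχ
  irreducible W'' h₁ h₂ hst := by
    have hχ' : χ⁻¹.IsFiniteOrder := IsOfFinOrder.inv hχ
    have hst' := hst.map_mulChar_detTwist hχ'
    rw [detTwist_inv] at hst'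
    have h₁' : π.W' ≤ W''.map (mulChar (detTwist n χ)⁻¹) := by
      rw [← map_mulChar_inv_map_mulChar (detTwist n χ) π.W']
      exact Submodule.map_mono h₁
    have h₂' : W''.map (mulChar (detTwist n χ)⁻¹) ≤ π.W := by
      rw [← map_mulChar_inv_map_mulChar (detTwist n χ) π.W]
      exact Submodule.map_mono h₂
    rcases π.irreducible _ h₁' h₂' hst' with h | h
    · left
      rw [← map_mulChar_map_mulChar_inv (detTwist n χ) W'', h]
    · right
      rw [← map_mulChar_map_mulChar_inv (detTwist n χ) W'', h]

/-- The forms of `π ⊗ (χ ∘ det)` are the `(χ ∘ det) · φ`, `φ ∈ W` (definitional). [folklore] -/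
@[simp]
theorem AutomorphicRepData.twist_W (π : AutomorphicRepData (AutomorphyDatum.gl n K hcpt))
    (χ : GaloisRepresentations.HeckeCharacter K) (hχ : χ.IsFiniteOrder) :
    (π.twist χ hχ).W = π.W.map (mulChar (detTwist n χ)) := rfl

/-- The small space of `π ⊗ (χ ∘ det)` is `W' · (χ ∘ det)` (definitional). [folklore] -/
@[simp]
theorem AutomorphicRepData.twist_W' (π : AutomorphicRepData (AutomorphyDatum.gl n K hcpt))
    (χ : GaloisRepresentations.HeckeCharacter K) (hχ : χ.IsFiniteOrder) :
    (π.twist χ hχ).W' = π.W'.map (mulChar (detTwist n χ)) := rfl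

/-- **Twisting preserves the cusp conditions**: `(χ ∘ det)` is trivial on the unipotent
radicals, so the constant terms of `(χ ∘ det) · φ` are `χ(det g)` times those of `φ`.
Borel–Jacquet 1979, 4.4. [cite: BorelJacquet1979, 4.4] -/
theorem CuspConditionGL.mulChar_detTwist (χ : GaloisRepresentations.HeckeCharacter K)
    {φ : (AdelicGroupData.gl n K).Adelic → ℂ} {k : ℕ} (hφ : CuspConditionGL n K φ k) :
    CuspConditionGL n K (mulChar (detTwist n χ) φ) k := by
  intro ν _ 𝓕 h𝓕 g
  obtain ⟨hi, h0⟩ := hφ ν 𝓕 h𝓕 g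
  have heq : ∀ X : blockNilpotent n k (AdeleRing (𝓞 K) K),
      mulChar (detTwist n χ) φ (glUnipotent n k K (Multiplicative.ofAdd X) * g) =
        (detTwist n χ g : ℂ) * φ (glUnipotent n k K (Multiplicative.ofAdd X) * g) := fun X => by
    rw [mulChar_apply, map_mul, detTwist_glUnipotent, one_mul]
  simp only [heq]
  refine ⟨hi.const_mul _, ?_⟩
  rw [MeasureTheory.integral_const_mul, h0, mul_zero]

/-- **Twists of cusp forms are cusp forms.** Borel–Jacquet 1979, 4.4.
[cite: BorelJacquet1979, 4.4] -/
theorem IsCuspFormGL.mulChar_detTwist {χ : GaloisRepresentations.HeckeCharacter K} (hχ : χ.IsFiniteOrder)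
    {φ : (AdelicGroupData.gl n K).Adelic → ℂ} (hφ : IsCuspFormGL n K hcpt φ) :
    IsCuspFormGL n K hcpt (mulChar (detTwist n χ) φ) :=
  ⟨hφ.1.mulChar_detTwist hχ, fun k hk hkn => (hφ.2 k hk hkn).mulChar_detTwist χ⟩

/-- The twist of a space of cusp forms consists of cusp forms. Borel–Jacquet 1979, 4.4–4.6.
[cite: BorelJacquet1979, 4.4–4.6] -/
theorem map_mulChar_le_cuspFormsGL {χ : GaloisRepresentations.HeckeCharacter K} (hχ : χ.IsFiniteOrder)
    {W : Submodule ℂ ((AdelicGroupData.gl n K).Adelic → ℂ)} (hW : W ≤ cuspFormsGL n K hcpt) :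
    W.map (mulChar (detTwist n χ)) ≤ cuspFormsGL n K hcpt := by
  refine (Submodule.map_mono hW).trans ?_
  rw [cuspFormsGL, Submodule.map_span, Submodule.span_le]
  rintro _ ⟨φ, hφ, rfl⟩
  exact Submodule.subset_span (IsCuspFormGL.mulChar_detTwist hχ hφ)

/-- **The twist `π ⊗ (χ ∘ det)` of a cuspidal automorphic representation of `GL_n(𝔸_K)`** by a
Hecke character of finite order is a cuspidal automorphic representation (Jacquet–Langlands,
LNM 114 (1970), §11; Arthur–Clozel 1989, Ch. 3 §§3–4: the twists `π ⊗ ηⁱ` of a cuspidal `π`).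
[cite: ArthurClozelAMS120, Ch. 3, Thm. 3.1 (p. 172)] -/
def CuspidalAutomorphicRepData.twist (π : CuspidalAutomorphicRepData n K hcpt)
    (χ : GaloisRepresentations.HeckeCharacter K) (hχ : χ.IsFiniteOrder) : CuspidalAutomorphicRepData n K hcpt :=
  ⟨π.1.twist χ hχ, map_mulChar_le_cuspFormsGL hχ π.2⟩

/-- The underlying automorphic representation of the cuspidal twist (definitional). [folklore] -/
@[simp]
theorem CuspidalAutomorphicRepData.twist_val (π : CuspidalAutomorphicRepData n K hcpt)
    (χ : GaloisRepresentations.HeckeCharacter K) (hχ : χ.IsFiniteOrder) :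
    (π.twist χ hχ).1 = π.1.twist χ hχ := rfl

end Forms

/-! ### Satake parameters of the twist: `t_{π ⊗ χ, v} = χ(ϖ_v) t_{π, v}` -/

section Satake

open scoped Classical

variable {n : ℕ} {K : Type} [Field K] [NumberField K] {hcpt : isCompact_glFiniteIntegralLevel n K}

/-- **Satake parameters of `π ⊗ (χ ∘ det)`** (Arthur–Clozel 1989, Ch. 3, proof of Thm. 3.1,
p. 172: "`ζ_v = η(ϖ_v)`", i.e. `t_{π ⊗ η, v} = η(ϖ_v) t_{π, v}`; Jacquet–Langlands 1970, §11).
If `π` has Satake parameter `α` at `v` (witnessed at a level `K(𝔫)`, `v ∤ 𝔫`, and a uniformizer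
`ϖ`), `χ` has finite order and `χ ∘ det` is trivial on `K(𝔪)` with `v ∤ 𝔪`, then `π ⊗ (χ ∘ det)`
has Satake parameter `χ_v(ϖ) · α` at `v`, witnessed at level `K(𝔫𝔪)` by `(χ ∘ det) · φ`: the
Hecke operators at levels `K(𝔫)` and `K(𝔫𝔪)` agree on `K(𝔫)`-fixed forms (both are the local
operators, `heckeOperator_sphericalLevelAt_eq_principalCongruenceLevel`),
`[K t_{v,i} K] ((χ∘det) φ) = χ(det t_{v,i}) (χ∘det) [K t_{v,i} K] φ` with `det t_{v,i} = ϖ^i`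
(`heckeOperator_apply_semilinear`, `det_heckeDiagAt`), and `e_i(z α) = z^i e_i(α)`.
[cite: ArthurClozelAMS120, Ch. 3, proof of Thm. 3.1 (p. 172)] -/
theorem AutomorphicRepData.HasSatakeParamAt.twist {π : AutomorphicRepData (AutomorphyDatum.gl n K hcpt)}
    {v : HeightOneSpectrum (𝓞 K)} {α : Multiset ℂ} (h : π.HasSatakeParamAt v α)
    {χ : GaloisRepresentations.HeckeCharacter K} (hχ : χ.IsFiniteOrder) {𝔪 : Ideal (𝓞 K)} (h𝔪 : 𝔪 ≠ 0)
    (hχ𝔪 : ∀ k ∈ principalCongruenceLevel n K 𝔪, χ (Matrix.GeneralLinearGroup.det k) = 1)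
    (hv : ¬ v.asIdeal ∣ 𝔪) :
    ∃ ϖ : (v.adicCompletion K)ˣ, Valued.v (ϖ : v.adicCompletion K) = WithZero.exp (-1 : ℤ) ∧
      (π.twist χ hχ).HasSatakeParamAt v
        (α.map (((χ (GaloisRepresentations.localUnits v ϖ) : ℂˣ) : ℂ) * ·)) := by
  obtain ⟨𝔫, ϖ, h𝔫, hv𝔫, hϖ, hcard, φ, hφW, hφW', hfix, hT⟩ := h
  set c := detTwist n χ with hc
  set z : ℂ := ((χ (GaloisRepresentations.localUnits v ϖ) : ℂˣ) : ℂ) with hz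
  have h𝔫𝔪 : 𝔫 * 𝔪 ≠ 0 := mul_ne_zero h𝔫 h𝔪
  have hv' : ¬ v.asIdeal ∣ 𝔫 * 𝔪 := by
    intro hdvd
    rcases (Ideal.IsPrime.mul_le v.isPrime).mp (Ideal.le_of_dvd hdvd) with h | h
    · exact hv𝔫 (Ideal.dvd_iff_le.mpr h)
    · exact hv (Ideal.dvd_iff_le.mpr h)
  have hle𝔫 : principalCongruenceLevel n K (𝔫 * 𝔪) ≤ principalCongruenceLevel n K 𝔫 :=
    principalCongruenceLevel_mono n K h𝔫𝔪 Ideal.mul_le_right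
  have hle𝔪 : principalCongruenceLevel n K (𝔫 * 𝔪) ≤ principalCongruenceLevel n K 𝔪 :=
    principalCongruenceLevel_mono n K h𝔫𝔪 Ideal.mul_le_left
  have hcU : ∀ u ∈ principalCongruenceLevel n K (𝔫 * 𝔪), c u = 1 := fun u hu => hχ𝔪 u (hle𝔪 hu)
  -- `φ` is fixed by `K(𝔫)` and `K(𝔫𝔪)`
  have hφfix : φ ∈ (rightTranslation (AdelicGroupData.gl n K)).fixedPoints
      (principalCongruenceLevel n K 𝔫) :=
    (isRightInvariantUnder_iff_mem_fixedPoints _ _ _).mp fun u hu g => congrFun (hfix u hu) g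
  have hφfix' : φ ∈ (rightTranslation (AdelicGroupData.gl n K)).fixedPoints
      (principalCongruenceLevel n K (𝔫 * 𝔪)) :=
    (isRightInvariantUnder_iff_mem_fixedPoints _ _ _).mp fun u hu g => congrFun (hfix u (hle𝔫 hu)) g
  refine ⟨ϖ, hϖ, 𝔫 * 𝔪, ϖ, h𝔫𝔪, hv', hϖ, by rw [Multiset.card_map, hcard], mulChar c φ,
    Submodule.mem_map_of_mem hφW, fun hmem => hφW' ((mulChar_mem_map_mulChar_iff _ _ _).mp hmem),
    fun u hu => ?_, fun i hi => ?_⟩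
  · rw [rightTranslation_mulChar, hfix u (hle𝔫 hu), hcU u hu, Units.val_one, one_smul]
  · -- change of level for `φ`
    have hlev : heckeOperator (rightTranslation (AdelicGroupData.gl n K))
        (principalCongruenceLevel n K (𝔫 * 𝔪)) (heckeDiagAt n K v ϖ i) φ =
        heckeOperator (rightTranslation (AdelicGroupData.gl n K))
          (principalCongruenceLevel n K 𝔫) (heckeDiagAt n K v ϖ i) φ := by
      rw [heckeDiagAt_eq_ofLocal_glDiagonal]
      exact (heckeOperator_sphericalLevelAt_eq_principalCongruenceLevel
          (rightTranslation (AdelicGroupData.gl n K)) h𝔫𝔪 hv' _ hφfix').symm.trans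
        (heckeOperator_sphericalLevelAt_eq_principalCongruenceLevel
          (rightTranslation (AdelicGroupData.gl n K)) h𝔫 hv𝔫 _ hφfix)
    -- the twisted Hecke operator
    have htw : heckeOperator (rightTranslation (AdelicGroupData.gl n K))
        (principalCongruenceLevel n K (𝔫 * 𝔪)) (heckeDiagAt n K v ϖ i) (mulChar c φ) =
        (c (heckeDiagAt n K v ϖ i) : ℂ) • mulChar c (heckeOperator (rightTranslation (AdelicGroupData.gl n K))
          (principalCongruenceLevel n K (𝔫 * 𝔪)) (heckeDiagAt n K v ϖ i) φ) :=
      heckeOperator_apply_semilinear _ _ (mulChar c) (fun x => (c x : ℂ))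
        (fun x ψ => rightTranslation_mulChar _ c x ψ) _
        (fun y hy => by rw [apply_out_eq_of_mem_orbit c _ hcU _ hy]) φ
    have hct : (c (heckeDiagAt n K v ϖ i) : ℂ) = z ^ i := by
      rw [hc, detTwist_apply, det_heckeDiagAt v ϖ hi, map_pow, Units.val_pow_eq_pow_val]
    rw [htw, hlev, hct, esymm_map_const_mul]
    have key : z ^ i • mulChar c (heckeOperator (rightTranslation (AdelicGroupData.gl n K))
          (principalCongruenceLevel n K 𝔫) (heckeDiagAt n K v ϖ i) φ) -
        ((((Real.sqrt (v.residueCard : ℝ)) : ℝ) : ℂ) ^ (i * (n - i)) * (z ^ i * α.esymm i)) •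
          mulChar c φ =
        mulChar c (z ^ i • (heckeOperator (rightTranslation (AdelicGroupData.gl n K))
          (principalCongruenceLevel n K 𝔫) (heckeDiagAt n K v ϖ i) φ -
            ((((Real.sqrt (v.residueCard : ℝ)) : ℝ) : ℂ) ^ (i * (n - i)) * α.esymm i) • φ)) := by
      rw [map_smul, map_sub, map_smul, smul_sub, smul_smul, mul_left_comm]
    rw [key]
    exact Submodule.mem_map_of_mem (Submodule.smul_mem _ _ (hT i hi))

/-- **Satake parameters of `π ⊗ (χ ∘ det)` at an unramified place of `χ`**: if moreover `χ` is
unramified at `v`, the Satake parameter of the twist at `v` is `χ(ϖ_v) · α`, with `χ(ϖ_v)` the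
(well-defined) value at any uniformizer (`HeckeCharacter.valueAtUniformizer`). Arthur–Clozel
1989, Ch. 3, proof of Thm. 3.1 (p. 172). [cite: ArthurClozelAMS120, Ch. 3, proof of Thm. 3.1 (p. 172)] -/
theorem AutomorphicRepData.HasSatakeParamAt.twist_of_isUnramifiedAt
    {π : AutomorphicRepData (AutomorphyDatum.gl n K hcpt)}
    {v : HeightOneSpectrum (𝓞 K)} {α : Multiset ℂ} (h : π.HasSatakeParamAt v α)
    {χ : GaloisRepresentations.HeckeCharacter K} (hχ : χ.IsFiniteOrder) {𝔪 : Ideal (𝓞 K)} (h𝔪 : 𝔪 ≠ 0)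
    (hχ𝔪 : ∀ k ∈ principalCongruenceLevel n K 𝔪, χ (Matrix.GeneralLinearGroup.det k) = 1)
    (hv : ¬ v.asIdeal ∣ 𝔪) (hvu : χ.IsUnramifiedAt v) :
    (π.twist χ hχ).HasSatakeParamAt v (α.map (χ.valueAtUniformizer v * ·)) := by
  obtain ⟨ϖ, hϖ, hS⟩ := h.twist hχ h𝔪 hχ𝔪 hv
  rwa [← GaloisRepresentations.HeckeCharacter.localComponent_apply,
    GaloisRepresentations.HeckeCharacter.localComponent_eq_valueAtUniformizer hvu hϖ] at hS

/-- **Almost everywhere form.** For `χ` of finite order there is a finite set of places (the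
primes of a level `𝔪` of `χ ∘ det` and the ramified places of `χ`) outside which every Satake
parameter `α` of `π` at `v` gives the Satake parameter `χ(ϖ_v) · α` of `π ⊗ (χ ∘ det)` at `v`.
Arthur–Clozel 1989, Ch. 3, proof of Thm. 3.1 (p. 172).
[cite: ArthurClozelAMS120, Ch. 3, proof of Thm. 3.1 (p. 172)] -/
theorem AutomorphicRepData.eventually_hasSatakeParamAt_twist
    (π : AutomorphicRepData (AutomorphyDatum.gl n K hcpt))
    {χ : GaloisRepresentations.HeckeCharacter K} (hχ : χ.IsFiniteOrder) :
    ∀ᶠ v : HeightOneSpectrum (𝓞 K) in Filter.cofinite, ∀ α : Multiset ℂ,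
      π.HasSatakeParamAt v α → (π.twist χ hχ).HasSatakeParamAt v (α.map (χ.valueAtUniformizer v * ·)) := by
  obtain ⟨𝔪, h𝔪, hχ𝔪⟩ := GaloisRepresentations.HeckeCharacter.exists_level_of_isFiniteOrder n hχ
  have h1 : ∀ᶠ v : HeightOneSpectrum (𝓞 K) in Filter.cofinite, ¬ v.asIdeal ∣ 𝔪 := by
    rw [Filter.eventually_cofinite]
    simpa only [not_not] using Ideal.finite_factors h𝔪
  have h2 : ∀ᶠ v : HeightOneSpectrum (𝓞 K) in Filter.cofinite, χ.IsUnramifiedAt v :=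
    (GaloisRepresentations.HeckeCharacter.finite_ramifiedPlaces_iff χ).mp χ.finite_ramifiedPlaces_holds
  filter_upwards [h1, h2] with v hv hvu α hα
  exact hα.twist_of_isUnramifiedAt hχ h𝔪 hχ𝔪 hv hvu

end Satake

end Literature.NumberTheory.Automorphic

end
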